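import Summits.QuantumFields.YangMills.Theorems.FemtoTransferGapRungW1upTrial

/-!
# Femto transfer gap — the one-site upper rung `λ₁(B,1) ≥ e^{−C λ_b(B)} λ₀(B,1)` (rung W1-up)

Support module of the `FemtoTransferGap` group (cell `ym-beyond`, seat P1; route `LuscherReduction`, crux `OneSiteLevels`
= `stmt-QuantumFields-20007`).  It PROVES, sorry-free, the registered BC5 rung of that crux,

  `rungUpperK1 : ∃ C B0 : ℝ, ∀ B : ℝ, B0 ≤ B → Real.exp (-(C * bareLambda B)) * levelValue su2Rep 1 B 0 ≤ levelValue su2Rep 1 B 1`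

(verbatim the skeleton's `RungUpperK1` / `stub_rungW1up`), i.e. on the ONE-SITE lattice `L = 1` (three links, three plaquettes, the
gauge group acting by simultaneous conjugation) the first min–max value of the zero-flux Wilson transfer kernel is not parametrically
below the top value as `B → ∞`: the ratio is `≥ 1 − K λ_b(B)`, `λ_b(B) = (2/B)^{1/3}`, with an explicit (astronomical, unoptimised) `K`.

## The argument (variational / min–max: Schur test upward, a disjoint trial pair downward)
* (A) SCHUR.  `K_B(U,V) ≤ E_B(U,V) := ∏ₑ w_B(Uₑ Vₑ⁻¹)`, `w_B(W) = e^{B Re tr W}` (the magnetic factor is `≤ 1`), and `E_B` is a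
  convolution kernel link by link, so `⟨ψ, K_B ψ⟩ ≤ c_B^{|E|} ‖ψ‖²` with `c_B = ∫ w_B`; hence `topValue ≤ c_B^{|E|}` (`topValue_le_linkCE`).
* (B) TRIAL PAIR.  With `vacDist W = min(‖W − 1‖_F, ‖W + 1‖_F)` (Frobenius distance to the centre = the classical vacuum manifold of
  the one-site model; conjugation- and centre-invariant, so profiles of it give PHYSICAL states) take the ball profile `g_a`
  (`= 1` on `vacDist ≤ r/2`, `= 0` off `vacDist < r`) and the annulus profile `g_b` (supported in `2r < vacDist < 3r`), `r = λ_b(B)`;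
  `a = g_a ⊗ g_a ⊗ g_a`, `b = g_b ⊗ g_a ⊗ g_a`.  For any physical `φ`, `ψ = ⟨b,φ⟩ a − ⟨a,φ⟩ b` is physical, `⊥ φ`, and (disjoint
  supports) `‖ψ‖² = ⟨b,φ⟩² ‖a‖² + ⟨a,φ⟩² ‖b‖² > 0`.
* (C) ONE-LINK ESTIMATES (Haar probability on `SU(2)`).  Markov deficit identity `c ∫g² − q(g,g) = ½ ∬ w(uv⁻¹)(g u − g v)²`, so
  for a `Λ`-Lipschitz `g` vanishing off `N`: deficit `≤ Λ² M₂ σ(N)` with `M₂ = ∫ ‖W − 1‖_F² w_B ≤ (cM2/B)·c_B` (pinned Laplace bound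
  `integral_sq_mul_exp_neg_le_of_two_sided` + Haar-ball doubling `σ(2ρ-ball) ≤ 5⁸ σ(ρ-ball)`); separated supports (`dist ≥ r`):
  `q(g,h) ≤ (M₂/r²) ∫ g` (Chebyshev tail); Haar balls have positive volume.
* (D) NUMBERS.  On `supp a ∪ supp b` every link has `vacDist ≤ 3r`, so the Wilson action is `≤ s₀ = 162 |P| r⁴` by the commutator
  bound `2 − Re tr(A B A⁻¹ B⁻¹) ≤ 2 vacDist(A)² vacDist(B)²`, and `K_B ≥ e^{−B s₀} E_B` there.  Since `B r³ = 2`, EVERY error term is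
  linear in `r` (`1/(B r²) = r/2`, `B r⁴ = 2r`): `⟨ψ, K_B ψ⟩ ≥ (1 − K r) c_B^{|E|} ‖ψ‖²` (`trial_rayleigh`; real-number core
  `core_ineq`), whence `secondValue ≥ (1 − K r) c_B^{|E|} ≥ e^{−2K r} topValue` for `r ≤ r_* = min(4/5, 1/(2K))`, i.e. for
  `B ≥ 2/r_*³` (`secondValue_ge`, `rungUpperK1` with `C = 2K`).

Companion modules (imported in a chain): `…RungW1upAlgebra` — `SU(2)` algebra (`negOne`, `vacDist`, trace identities, commutator
bound) · `…RungW1upLink` — `diagSU2`, one-link weight `linkW`, `linkC`, `linkM2`, ball volumes · `…RungW1upDeficit` — the deficit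
identity and tails · `…RungW1upSite` — the one-site lattice (`linkE`, Schur bound, physical product states, factorisation) ·
`…RungW1upProfiles` — the profiles and their volumes · `…RungW1upTrial` — trial states and the kernel bound · THIS FILE — the numbers
(`core_ineq`, `trial_rayleigh`, `secondValue_ge`) and the rung `rungUpperK1`.

## WHAT THIS IS NOT
NOT THE CLAY GAP, and no statement about `L → ∞` or a continuum limit: a finite-dimensional (`L = 1`) variational inequality between
two min–max values of an explicit compact integral operator at bare coupling `B → ∞`.  The companion rung K1 (`stub_rungK1`:
`λ₁ ≤ e^{−c λ_b} λ₀`) and the two `OneSiteLevels` energy stubs remain open.  Everything below is proved (no `sorry`, no new axiom).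
-/

set_option autoImplicit false

noncomputable section

open MeasureTheory Filter Topology Real
open scoped Matrix ComplexConjugate
open Literature.MathematicalPhysics.QuantumFieldTheory
open Literature.MathematicalPhysics.QuantumLattice

namespace Summit.QuantumFields.YangMills.Theorems.FemtoTransferGap

/-! ### D.5 The numbers

All error terms are LINEAR in `r = λ_b(B) = (2/B)^{1/3}` because `B r³ = 2`: the Lipschitz deficits are `∝ M₂/(c r²) ∝ 1/(B r²) = r/2`,
the separated-support tails likewise, and the magnetic suppression on the support region is `B s₀ = 162 |P| B r⁴ = 324 |P| r`. -/

/-- `|E| = 3` on the one-site lattice. [folklore] -/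
theorem card_edge_one : Fintype.card (Edge 3 1) = 3 := by
  simp [Edge, Site, Fintype.card_prod, Fintype.card_fin]

set_option maxHeartbeats 800000 in
/-- **The real-number core** of the estimate (with `|E| − 1 = 2`). [folklore] -/
theorem core_ineq {c na nb v ma T δa δb Qaa Qbb Qab Qba es xs xa xb xe : ℝ} (p q : ℝ)
    (hc : 0 < c) (hv : 0 < v) (hna : v ≤ na) (hnb : v ≤ nb) (hma : 0 ≤ ma) (hT : 0 ≤ T)
    (hQaa1 : Qaa ≤ c * na) (hQaa2 : c * na - Qaa ≤ δa) (hQbb : c * nb - Qbb ≤ δb)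
    (_hQab0 : 0 ≤ Qab) (hQab : Qab ≤ T * ma) (_hQba0 : 0 ≤ Qba) (hQba : Qba ≤ T * ma)
    (hδa : δa ≤ xa * (c * na)) (hδb : δb ≤ xb * (c * nb)) (hTe : T * ma ≤ xe * c * v)
    (hes0 : 0 ≤ es) (hes : 1 - xs ≤ es) (hxs : 0 ≤ xs) (hxa0 : 0 ≤ xa) (hxab : xa ≤ xb) (hxb1 : xb ≤ 1)
    (hkxa : 2 * xa ≤ 1) (hxe : 0 ≤ xe) :
    (1 - xs - xb - 2 * xa - xe) * (c ^ 3 * na ^ 2 * (q ^ 2 * na + p ^ 2 * nb)) ≤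
      es * (q ^ 2 * (Qaa * Qaa ^ 2) + p ^ 2 * (Qbb * Qaa ^ 2)) - |p| * |q| * (Qab * Qaa ^ 2 + Qba * Qaa ^ 2) := by
  have hna0 : 0 < na := lt_of_lt_of_le hv hna
  have hnb0 : 0 < nb := lt_of_lt_of_le hv hnb
  have hcna : 0 ≤ c * na := by positivity
  have hcnb : 0 ≤ c * nb := by positivity
  have hxa1 : xa ≤ 1 := hxab.trans hxb1
  -- lower bounds for the diagonal one-link forms
  have hLa : (1 - xa) * (c * na) ≤ Qaa := by linarith
  have hLa0 : 0 ≤ (1 - xa) * (c * na) := mul_nonneg (by linarith) hcna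
  have hQaa0 : 0 ≤ Qaa := hLa0.trans hLa
  have hLb : (1 - xb) * (c * nb) ≤ Qbb := by linarith
  have hP1 : ((1 - xa) * (c * na)) ^ 2 ≤ Qaa ^ 2 := pow_le_pow_left₀ hLa0 hLa 2
  have hP2 : Qaa ^ 2 ≤ (c * na) ^ 2 := pow_le_pow_left₀ hQaa0 hQaa1 2
  have hP0 : 0 ≤ Qaa ^ 2 := pow_nonneg hQaa0 2
  have hbern : 1 - 2 * xa ≤ (1 - xa) ^ 2 := by linarith [sq_nonneg xa]
  -- the main (diagonal) part
  have hW : (1 - xb) * c * (q ^ 2 * na + p ^ 2 * nb) ≤ q ^ 2 * Qaa + p ^ 2 * Qbb := by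
    have h1 : q ^ 2 * ((1 - xa) * (c * na)) ≤ q ^ 2 * Qaa := mul_le_mul_of_nonneg_left hLa (sq_nonneg q)
    have h2 : p ^ 2 * ((1 - xb) * (c * nb)) ≤ p ^ 2 * Qbb := mul_le_mul_of_nonneg_left hLb (sq_nonneg p)
    have h3 : q ^ 2 * ((1 - xb) * (c * na)) ≤ q ^ 2 * ((1 - xa) * (c * na)) :=
      mul_le_mul_of_nonneg_left (mul_le_mul_of_nonneg_right (by linarith) hcna) (sq_nonneg q)
    linarith [h1, h2, h3]
  have hB1 : 0 ≤ 1 - xb := by linarith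
  have hS0 : 0 ≤ q ^ 2 * na + p ^ 2 * nb := by positivity
  have hW0 : 0 ≤ (1 - xb) * c * (q ^ 2 * na + p ^ 2 * nb) := mul_nonneg (mul_nonneg hB1 hc.le) hS0
  have hmain : es * (((1 - xb) * c * (q ^ 2 * na + p ^ 2 * nb)) * ((1 - xa) ^ 2 * (c * na) ^ 2)) ≤
      es * ((q ^ 2 * Qaa + p ^ 2 * Qbb) * Qaa ^ 2) := by
    refine mul_le_mul_of_nonneg_left ?_ hes0
    calc ((1 - xb) * c * (q ^ 2 * na + p ^ 2 * nb)) * ((1 - xa) ^ 2 * (c * na) ^ 2)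
        = ((1 - xb) * c * (q ^ 2 * na + p ^ 2 * nb)) * (((1 - xa) * (c * na)) ^ 2) := by ring
      _ ≤ ((1 - xb) * c * (q ^ 2 * na + p ^ 2 * nb)) * Qaa ^ 2 := mul_le_mul_of_nonneg_left hP1 hW0
      _ ≤ (q ^ 2 * Qaa + p ^ 2 * Qbb) * Qaa ^ 2 := mul_le_mul_of_nonneg_right hW hP0
  -- the cross part (AM–GM with the separated-support tails)
  have hamgm : 2 * |p| * |q| * v ≤ q ^ 2 * na + p ^ 2 * nb := by
    have h1 : 2 * |p| * |q| ≤ p ^ 2 + q ^ 2 := by linarith [sq_nonneg (|p| - |q|), sq_abs p, sq_abs q]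
    have h2 : q ^ 2 * v ≤ q ^ 2 * na := mul_le_mul_of_nonneg_left hna (sq_nonneg q)
    have h3 : p ^ 2 * v ≤ p ^ 2 * nb := mul_le_mul_of_nonneg_left hnb (sq_nonneg p)
    calc 2 * |p| * |q| * v = (2 * |p| * |q|) * v := by ring
      _ ≤ (p ^ 2 + q ^ 2) * v := mul_le_mul_of_nonneg_right h1 hv.le
      _ = q ^ 2 * v + p ^ 2 * v := by ring
      _ ≤ q ^ 2 * na + p ^ 2 * nb := add_le_add h2 h3
  have hpq : 0 ≤ |p| * |q| := by positivity
  have hck : 0 ≤ (c * na) ^ 2 := by positivity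
  have hcross : |p| * |q| * (Qab * Qaa ^ 2 + Qba * Qaa ^ 2) ≤ xe * c * (q ^ 2 * na + p ^ 2 * nb) * (c * na) ^ 2 := by
    have h1 : Qab * Qaa ^ 2 + Qba * Qaa ^ 2 ≤ 2 * (T * ma) * (c * na) ^ 2 := by
      have := mul_le_mul (add_le_add hQab hQba) hP2 hP0 (by positivity : 0 ≤ T * ma + T * ma)
      linarith [this]
    have h2 : |p| * |q| * (Qab * Qaa ^ 2 + Qba * Qaa ^ 2) ≤ |p| * |q| * (2 * (T * ma) * (c * na) ^ 2) :=
      mul_le_mul_of_nonneg_left h1 hpq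
    have h3 : |p| * |q| * (2 * (T * ma)) ≤ xe * c * (q ^ 2 * na + p ^ 2 * nb) := by
      have h4 : |p| * |q| * (2 * (T * ma)) ≤ |p| * |q| * (2 * (xe * c * v)) := mul_le_mul_of_nonneg_left (by linarith) hpq
      have h5 : xe * c * (2 * |p| * |q| * v) ≤ xe * c * (q ^ 2 * na + p ^ 2 * nb) :=
        mul_le_mul_of_nonneg_left hamgm (by positivity)
      linarith [h4, h5]
    calc |p| * |q| * (Qab * Qaa ^ 2 + Qba * Qaa ^ 2) ≤ |p| * |q| * (2 * (T * ma) * (c * na) ^ 2) := h2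
      _ = (|p| * |q| * (2 * (T * ma))) * (c * na) ^ 2 := by ring
      _ ≤ (xe * c * (q ^ 2 * na + p ^ 2 * nb)) * (c * na) ^ 2 := mul_le_mul_of_nonneg_right h3 hck
  -- the prefactor
  have hfac : 1 - xs - xb - 2 * xa ≤ es * (1 - xb) * (1 - xa) ^ 2 := by
    have hy0 : 0 ≤ 1 - 2 * xa := by linarith
    have s1 : es * (1 - xb) * (1 - 2 * xa) ≤ es * (1 - xb) * (1 - xa) ^ 2 :=
      mul_le_mul_of_nonneg_left hbern (mul_nonneg hes0 hB1)
    have s2 : (1 - xs) * ((1 - xb) * (1 - 2 * xa)) ≤ es * ((1 - xb) * (1 - 2 * xa)) :=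
      mul_le_mul_of_nonneg_right hes (mul_nonneg hB1 hy0)
    have s3 : 1 - xs - xb - 2 * xa ≤ (1 - xs) * ((1 - xb) * (1 - 2 * xa)) := by
      have t1 : 0 ≤ xs * xb * (1 - 2 * xa) := mul_nonneg (mul_nonneg hxs (by linarith)) hy0
      have t2 : 0 ≤ (2 * xa) * (xs + xb) := mul_nonneg (by positivity) (by linarith)
      linarith [t1, t2]
    linarith [s1, s2, s3]
  have hZ0 : 0 ≤ c * (q ^ 2 * na + p ^ 2 * nb) * (c * na) ^ 2 := by positivity
  have hfin : (1 - xs - xb - 2 * xa - xe) * (c * (q ^ 2 * na + p ^ 2 * nb) * (c * na) ^ 2) ≤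
      (es * (1 - xb) * (1 - xa) ^ 2 - xe) * (c * (q ^ 2 * na + p ^ 2 * nb) * (c * na) ^ 2) :=
    mul_le_mul_of_nonneg_right (by linarith) hZ0
  have eZ : c ^ 3 * na ^ 2 * (q ^ 2 * na + p ^ 2 * nb) = c * (q ^ 2 * na + p ^ 2 * nb) * (c * na) ^ 2 := by ring
  rw [eZ]
  have e2 : es * (q ^ 2 * (Qaa * Qaa ^ 2) + p ^ 2 * (Qbb * Qaa ^ 2)) = es * ((q ^ 2 * Qaa + p ^ 2 * Qbb) * Qaa ^ 2) := by ring
  have e3 : es * (((1 - xb) * c * (q ^ 2 * na + p ^ 2 * nb)) * ((1 - xa) ^ 2 * (c * na) ^ 2)) =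
      (es * (1 - xb) * (1 - xa) ^ 2) * (c * (q ^ 2 * na + p ^ 2 * nb) * (c * na) ^ 2) := by ring
  have e4 : xe * c * (q ^ 2 * na + p ^ 2 * nb) * (c * na) ^ 2 = xe * (c * (q ^ 2 * na + p ^ 2 * nb) * (c * na) ^ 2) := by ring
  rw [e2]
  rw [e3] at hmain
  rw [e4] at hcross
  linarith [hfin, hmain, hcross]

/-- The constant `K` collecting the four linear-in-`r` error terms (magnetic suppression, annulus deficit, two ball deficits, tails).
[folklore] -/
def Kcon : ℝ := 324 * (Fintype.card (Plaquette 3 1) : ℝ) + 16 * 5 ^ 32 * cM2 + 2 * (4 * 5 ^ 16 * cM2) + 5 ^ 16 * cM2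

/-- `0 < K`. [folklore] -/
theorem Kcon_pos : 0 < Kcon := by unfold Kcon; have := cM2_pos; positivity

/-- The width threshold `r_* = min(4/5, 1/(2K))`. [folklore] -/
def rStar : ℝ := min (4 / 5) (1 / (2 * Kcon))

/-- `0 < r_*`. [folklore] -/
theorem rStar_pos : 0 < rStar := lt_min (by norm_num) (by have := Kcon_pos; positivity)

/-- `∫ g·g = ∫ g²`. [folklore] -/
theorem integral_mul_self_eq_sq (g : SU2 → ℝ) :
    ∫ u, g u * g u ∂haarProbability SU2 = ∫ u, g u ^ 2 ∂haarProbability SU2 := by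
  simp_rw [← pow_two]

set_option maxHeartbeats 800000 in
/-- **Rayleigh lower bound for the trial state**: `(1 − K r) c_B^{|E|} ‖ψ‖² ≤ ⟨ψ, K_B ψ⟩` in the regime
`B r³ = 2`, `r ≤ 4/5`, `K r ≤ 1/2`. [folklore] -/
theorem trial_rayleigh {B r : ℝ} (hB : 0 < B) (hr : 0 < r) (hr1 : r ≤ 4 / 5) (hBr : B * r ^ 3 = 2)
    (hKr : Kcon * r ≤ 1 / 2) (p q : ℝ) :
    (1 - Kcon * r) * (linkCE B * l2 (trial r p q) (trial r p q)) ≤ qform su2Rep B (trial r p q) (trial r p q) := by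
  have key := qform_trial_ge hB.le hr p q
  have eaa : qE B (stA r) (stA r) = linkQ B (profA r) (profA r) * linkQ B (profA r) (profA r) ^ 2 := by
    have := qE_linkState B (profA r) (profA r) (profA r); rwa [card_edge_one] at this
  have ebb : qE B (stB r) (stB r) = linkQ B (profB r) (profB r) * linkQ B (profA r) (profA r) ^ 2 := by
    have := qE_linkState B (profA r) (profB r) (profB r); rwa [card_edge_one] at this
  have eab : qE B (stA r) (stB r) = linkQ B (profA r) (profB r) * linkQ B (profA r) (profA r) ^ 2 := by
    have := qE_linkState B (profA r) (profA r) (profB r); rwa [card_edge_one] at this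
  have eba : qE B (stB r) (stA r) = linkQ B (profB r) (profA r) * linkQ B (profA r) (profA r) ^ 2 := by
    have := qE_linkState B (profA r) (profB r) (profA r); rwa [card_edge_one] at this
  have laa : l2 (stA r) (stA r) = (∫ u, profA r u ^ 2 ∂haarProbability SU2) * (∫ u, profA r u ^ 2 ∂haarProbability SU2) ^ 2 := by
    have := l2_linkState (profA r) (profA r) (profA r); rwa [card_edge_one, integral_mul_self_eq_sq] at this
  have lbb : l2 (stB r) (stB r) = (∫ u, profB r u ^ 2 ∂haarProbability SU2) * (∫ u, profA r u ^ 2 ∂haarProbability SU2) ^ 2 := by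
    have := l2_linkState (profA r) (profB r) (profB r); rwa [card_edge_one, integral_mul_self_eq_sq, integral_mul_self_eq_sq] at this
  rw [eaa, ebb, eab, eba] at key
  rw [l2_trial hr, laa, lbb, linkCE, card_edge_one]
  -- the one-link inputs
  have hga_m := (continuous_profA r).measurable
  have hgb_m := (continuous_profB r).measurable
  have hga_b : ∀ u, |profA r u| ≤ 1 := fun u => by rw [abs_of_nonneg (profA_nonneg r u)]; exact profA_le_one r u
  have hgb_b : ∀ u, |profB r u| ≤ 1 := fun u => by rw [abs_of_nonneg (profB_nonneg r u)]; exact profB_le_one r u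
  have hc := linkC_pos hB.le
  have hv := ballVol_pos (r := r / 4) (by positivity)
  have hna := ballVol_le_integral_profA_sq hr
  have hnb := ballVol_le_integral_profB_sq hr hr1
  have hma : 0 ≤ ∫ u, profA r u ∂haarProbability SU2 := integral_nonneg (profA_nonneg r)
  have hma1 : ∫ u, profA r u ∂haarProbability SU2 ≤ 2 * 5 ^ 16 * ballVol (r / 4) :=
    (integral_profA_le hr).trans (by linarith [ballVol_le_of_quarter hr.le])
  have hT := linkTail_nonneg B r
  have hQaa1 := linkQ_self_le hB.le hga_m hga_b
  have hQaa2 := linkQ_deficit_le hB.le hga_m hga_b (profA_lipschitz hr) (measurableSet_vacDist_le r) (profA_eq_zero_off hr)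
  have hQbb := linkQ_deficit_le hB.le hgb_m hgb_b (profB_lipschitz hr) (measurableSet_vacDist_le (3 * r)) (profB_eq_zero_off hr)
  have hQab0 := linkQ_nonneg B (profA_nonneg r) (profB_nonneg r)
  have hQba0 := linkQ_nonneg B (profB_nonneg r) (profA_nonneg r)
  have hQab := linkQ_le_tail_left hB.le hga_m hgb_m (profA_nonneg r) (profA_le_one r) (profB_nonneg r) (profB_le_one r)
    (fun u v hu hv => profA_profB_sep hr u v hu hv)
  have hQba := linkQ_le_tail_right hB.le hgb_m hga_m (profB_nonneg r) (profB_le_one r) (profA_nonneg r) (profA_le_one r)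
    (fun u v hu hv => profB_profA_sep hr u v hu hv)
  have hM := linkM2_le hB
  have hcM2 := cM2_pos
  have hM0 := linkM2_nonneg B
  have hTM := linkTail_le hB.le hr
  have hNa : (haarProbability SU2).real {W : SU2 | vacDist W ≤ r} ≤ 2 * 5 ^ 16 * ballVol (r / 4) :=
    (vacSet_real_le r).trans (by linarith [ballVol_le_of_quarter hr.le])
  have hNb : (haarProbability SU2).real {W : SU2 | vacDist W ≤ 3 * r} ≤ 2 * 5 ^ 32 * ballVol (r / 4) :=
    (vacSet_real_le (3 * r)).trans (by linarith [ballVol_three_le_of_quarter hr.le])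
  have hrne : r ≠ 0 := hr.ne'
  have hBne : B ≠ 0 := hB.ne'
  have hBinv : 1 / B = r ^ 3 / 2 := by
    rw [div_eq_div_iff hBne two_ne_zero]; linarith [hBr]
  -- the four linear-in-r error coefficients
  have hδa : (2 / r) ^ 2 * linkM2 B * (haarProbability SU2).real {W : SU2 | vacDist W ≤ r} ≤
      4 * 5 ^ 16 * cM2 * r * (linkC B * ∫ u, profA r u ^ 2 ∂haarProbability SU2) := by
    calc (2 / r) ^ 2 * linkM2 B * (haarProbability SU2).real {W : SU2 | vacDist W ≤ r}
        ≤ (2 / r) ^ 2 * (cM2 / B * linkC B) * (2 * 5 ^ 16 * ∫ u, profA r u ^ 2 ∂haarProbability SU2) :=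
          mul_le_mul (mul_le_mul_of_nonneg_left hM (by positivity)) (hNa.trans (mul_le_mul_of_nonneg_left hna (by norm_num)))
            measureReal_nonneg (by positivity)
      _ = 4 * 5 ^ 16 * cM2 * r * (linkC B * ∫ u, profA r u ^ 2 ∂haarProbability SU2) := by
          rw [div_eq_mul_one_div cM2 B, hBinv]; field_simp; try ring
  have hδb : (4 / r) ^ 2 * linkM2 B * (haarProbability SU2).real {W : SU2 | vacDist W ≤ 3 * r} ≤
      16 * 5 ^ 32 * cM2 * r * (linkC B * ∫ u, profB r u ^ 2 ∂haarProbability SU2) := by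
    calc (4 / r) ^ 2 * linkM2 B * (haarProbability SU2).real {W : SU2 | vacDist W ≤ 3 * r}
        ≤ (4 / r) ^ 2 * (cM2 / B * linkC B) * (2 * 5 ^ 32 * ∫ u, profB r u ^ 2 ∂haarProbability SU2) :=
          mul_le_mul (mul_le_mul_of_nonneg_left hM (by positivity)) (hNb.trans (mul_le_mul_of_nonneg_left hnb (by norm_num)))
            measureReal_nonneg (by positivity)
      _ = 16 * 5 ^ 32 * cM2 * r * (linkC B * ∫ u, profB r u ^ 2 ∂haarProbability SU2) := by
          rw [div_eq_mul_one_div cM2 B, hBinv]; field_simp; try ring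
  have hTe : linkTail B r * (∫ u, profA r u ∂haarProbability SU2) ≤ 5 ^ 16 * cM2 * r * linkC B * ballVol (r / 4) := by
    calc linkTail B r * (∫ u, profA r u ∂haarProbability SU2)
        ≤ (cM2 / B * linkC B / r ^ 2) * (2 * 5 ^ 16 * ballVol (r / 4)) :=
          mul_le_mul (hTM.trans (div_le_div_of_nonneg_right hM (by positivity))) hma1 hma (by positivity)
      _ = 5 ^ 16 * cM2 * r * linkC B * ballVol (r / 4) := by
          rw [div_eq_mul_one_div cM2 B, hBinv]; field_simp; try ring
  -- magnetic suppression
  have hs0 : B * s0 r = 324 * (Fintype.card (Plaquette 3 1) : ℝ) * r := by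
    unfold s0
    have h4 : B * r ^ 4 = 2 * r := by
      calc B * r ^ 4 = (B * r ^ 3) * r := by ring
        _ = 2 * r := by rw [hBr]
    calc B * ((Fintype.card (Plaquette 3 1) : ℝ) * (2 * (3 * r) ^ 2 * (3 * r) ^ 2))
        = 162 * (Fintype.card (Plaquette 3 1) : ℝ) * (B * r ^ 4) := by ring
      _ = 324 * (Fintype.card (Plaquette 3 1) : ℝ) * r := by rw [h4]; ring
  have hes : 1 - 324 * (Fintype.card (Plaquette 3 1) : ℝ) * r ≤ Real.exp (-(B * s0 r)) := by
    rw [hs0]; exact Real.one_sub_le_exp_neg _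
  -- sizes of the coefficients
  have hKdef : Kcon * r = 324 * (Fintype.card (Plaquette 3 1) : ℝ) * r + 16 * 5 ^ 32 * cM2 * r +
      2 * (4 * 5 ^ 16 * cM2 * r) + 5 ^ 16 * cM2 * r := by unfold Kcon; ring
  have hxs : 0 ≤ 324 * (Fintype.card (Plaquette 3 1) : ℝ) * r := by positivity
  have hxa0 : 0 ≤ 4 * 5 ^ 16 * cM2 * r := by positivity
  have hxab : 4 * 5 ^ 16 * cM2 * r ≤ 16 * 5 ^ 32 * cM2 * r := by nlinarith
  have hxe : 0 ≤ 5 ^ 16 * cM2 * r := by positivity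
  have hxb1 : 16 * 5 ^ 32 * cM2 * r ≤ 1 := by linarith
  have hkxa : 2 * (4 * 5 ^ 16 * cM2 * r) ≤ 1 := by linarith
  have core := core_ineq p q hc hv hna hnb hma hT hQaa1 hQaa2 hQbb hQab0 hQab hQba0 hQba hδa hδb hTe
    (Real.exp_pos _).le hes hxs hxa0 hxab hxb1 hkxa hxe
  have e1 : (1 - Kcon * r) = 1 - 324 * (Fintype.card (Plaquette 3 1) : ℝ) * r - 16 * 5 ^ 32 * cM2 * r -
      2 * (4 * 5 ^ 16 * cM2 * r) - 5 ^ 16 * cM2 * r := by rw [hKdef]; ring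
  rw [e1]
  calc _ = (1 - 324 * (Fintype.card (Plaquette 3 1) : ℝ) * r - 16 * 5 ^ 32 * cM2 * r - 2 * (4 * 5 ^ 16 * cM2 * r) -
        5 ^ 16 * cM2 * r) * (linkC B ^ 3 * (∫ u, profA r u ^ 2 ∂haarProbability SU2) ^ 2 *
        (q ^ 2 * (∫ u, profA r u ^ 2 ∂haarProbability SU2) + p ^ 2 * ∫ u, profB r u ^ 2 ∂haarProbability SU2)) := by ring
    _ ≤ _ := core
    _ ≤ _ := key

/-- `‖a‖² > 0`. [folklore] -/
theorem l2_stA_pos {r : ℝ} (hr : 0 < r) : 0 < l2 (stA r) (stA r) := by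
  have h := l2_linkState (profA r) (profA r) (profA r)
  rw [card_edge_one, integral_mul_self_eq_sq] at h
  have hna := lt_of_lt_of_le (ballVol_pos (r := r / 4) (by positivity)) (ballVol_le_integral_profA_sq hr)
  unfold stA; rw [h]; positivity

/-- `‖b‖² > 0` (`r ≤ 4/5`). [folklore] -/
theorem l2_stB_pos {r : ℝ} (hr : 0 < r) (hr1 : r ≤ 4 / 5) : 0 < l2 (stB r) (stB r) := by
  have h := l2_linkState (profA r) (profB r) (profB r)
  rw [card_edge_one, integral_mul_self_eq_sq, integral_mul_self_eq_sq] at h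
  have hna := lt_of_lt_of_le (ballVol_pos (r := r / 4) (by positivity)) (ballVol_le_integral_profA_sq hr)
  have hnb := lt_of_lt_of_le (ballVol_pos (r := r / 4) (by positivity)) (ballVol_le_integral_profB_sq hr hr1)
  unfold stB; rw [h]; positivity

/-- **Lower bound for the second value**: `(1 − K r) c_B^{|E|} ≤ λ₁(B, 1)` in the regime of `trial_rayleigh`. [folklore] -/
theorem secondValue_ge {B r : ℝ} (hB : 0 < B) (hr : 0 < r) (hr1 : r ≤ 4 / 5) (hBr : B * r ^ 3 = 2)
    (hKr : Kcon * r ≤ 1 / 2) : (1 - Kcon * r) * linkCE B ≤ secondValue su2Rep 1 B := by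
  unfold secondValue
  refine le_csInf ⟨_, ⟨fun _ => 1, isPhys_const 1, rfl⟩⟩ ?_
  rintro s ⟨φ, hφ, rfl⟩
  -- the trial state orthogonal to φ
  have main : ∀ p q : ℝ, l2 (trial r p q) φ = 0 → 0 < l2 (trial r p q) (trial r p q) →
      (1 - Kcon * r) * linkCE B ≤ sSup (rayleighSet su2Rep 1 B fun ψ => l2 ψ φ = 0) := by
    intro p q horth hpos
    refine le_csSup_of_le (bddAbove_rayleighSet_su2Rep 1 B _) ⟨trial r p q, isPhys_trial r p q, horth, hpos, rfl⟩ ?_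
    rw [le_div_iff₀ hpos, mul_assoc]
    exact trial_rayleigh hB hr hr1 hBr hKr p q
  by_cases hp : l2 (stA r) φ = 0
  · refine main 0 1 ?_ ?_
    · rw [l2_trial_left 0 1 hφ, hp]; ring
    · rw [l2_trial hr]; norm_num; exact l2_stA_pos hr
  · refine main (l2 (stA r) φ) (l2 (stB r) φ) ?_ ?_
    · rw [l2_trial_left _ _ hφ]; ring
    · rw [l2_trial hr]
      have ha := l2_stA_pos hr
      have hb := l2_stB_pos hr hr1
      have hp2 : 0 < l2 (stA r) φ ^ 2 := by positivity
      exact add_pos_of_nonneg_of_pos (mul_nonneg (sq_nonneg _) ha.le) (mul_pos hp2 hb)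

/-- `λ_b(B)³ B = 2` (`B > 0`). [folklore] -/
theorem bareLambda_cube {B : ℝ} (hB : 0 < B) : B * bareLambda B ^ 3 = 2 := by
  unfold bareLambda
  have e : (1 : ℝ) / 3 = ((3 : ℕ) : ℝ)⁻¹ := by norm_num
  rw [e, Real.rpow_inv_natCast_pow (by positivity) (by norm_num)]
  field_simp

/-- `0 < λ_b(B)` (`B > 0`). [folklore] -/
theorem bareLambda_pos' {B : ℝ} (hB : 0 < B) : 0 < bareLambda B := by
  unfold bareLambda; exact Real.rpow_pos_of_pos (by positivity) _

/-- `λ_b` is antitone on `B > 0`: `B₀ ≤ B ⇒ λ_b(B) ≤ λ_b(B₀)`, in the form `λ_b(B) ≤ r_*` for `B ≥ 2/r_*³`. [folklore] -/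
theorem bareLambda_le_of_le {B t : ℝ} (ht : 0 < t) (hB : 2 / t ^ 3 ≤ B) : bareLambda B ≤ t := by
  have hB0 : 0 < B := lt_of_lt_of_le (by positivity) hB
  have h1 : 2 / B ≤ t ^ 3 := by
    rw [div_le_iff₀ hB0]
    have := (div_le_iff₀ (pow_pos ht 3)).mp hB
    linarith
  unfold bareLambda
  have e : (1 : ℝ) / 3 = ((3 : ℕ) : ℝ)⁻¹ := by norm_num
  calc (2 / B) ^ ((1 : ℝ) / 3) ≤ (t ^ 3) ^ ((1 : ℝ) / 3) := Real.rpow_le_rpow (by positivity) h1 (by norm_num)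
    _ = t := by rw [e, Real.pow_rpow_inv_natCast ht.le (by norm_num)]

/-- **Rung W1-up (`RungUpperK1`, stub `stub_rungW1up` of crux `OneSiteLevels`)**: on the one-site lattice the first excited
min–max value is not parametrically below the top value at weak coupling —
`∃ C B₀, ∀ B ≥ B₀, e^{−C λ_b(B)} λ₀(B,1) ≤ λ₁(B,1)`, with the explicit `C = 2K`, `B₀ = 2/r_*³`. [folklore] -/
theorem rungUpperK1 : ∃ C B0 : ℝ, ∀ B : ℝ, B0 ≤ B →
    Real.exp (-(C * bareLambda B)) * levelValue su2Rep 1 B 0 ≤ levelValue su2Rep 1 B 1 := by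
  refine ⟨2 * Kcon, 2 / rStar ^ 3, fun B hB0 => ?_⟩
  have hrs := rStar_pos
  have hB : 0 < B := lt_of_lt_of_le (by positivity) hB0
  have hr := bareLambda_pos' hB
  have hBr := bareLambda_cube hB
  have hrle : bareLambda B ≤ rStar := bareLambda_le_of_le hrs hB0
  have hr1 : bareLambda B ≤ 4 / 5 := hrle.trans (min_le_left _ _)
  have hK := Kcon_pos
  have hKr : Kcon * bareLambda B ≤ 1 / 2 := by
    calc Kcon * bareLambda B ≤ Kcon * (1 / (2 * Kcon)) := mul_le_mul_of_nonneg_left (hrle.trans (min_le_right _ _)) hK.le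
      _ = 1 / 2 := by field_simp
  have h2 := secondValue_ge hB hr hr1 hBr hKr
  have h1 := topValue_le_linkCE hB.le
  have hexp : Real.exp (-(2 * Kcon * bareLambda B)) ≤ 1 - Kcon * bareLambda B := by
    -- `e^{−2y} ≤ 1 − y` for `0 ≤ y ≤ 1/2` (from `1 + 2y ≤ e^{2y}` and `(1 − y)(1 + 2y) ≥ 1`)
    have hy0 : 0 ≤ Kcon * bareLambda B := by positivity
    have hpos : 0 < 1 + 2 * (Kcon * bareLambda B) := by linarith
    have h2 : Real.exp (-(2 * (Kcon * bareLambda B))) * (1 + 2 * (Kcon * bareLambda B)) ≤ 1 := by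
      have := Real.add_one_le_exp (2 * (Kcon * bareLambda B))
      rw [Real.exp_neg, inv_mul_le_iff₀ (Real.exp_pos _)]
      linarith
    have h3 : 1 ≤ (1 - Kcon * bareLambda B) * (1 + 2 * (Kcon * bareLambda B)) := by nlinarith
    rw [mul_assoc]
    exact le_of_mul_le_mul_right (h2.trans h3) hpos
  rw [levelValue_zero, levelValue_one]
  calc Real.exp (-(2 * Kcon * bareLambda B)) * topValue su2Rep 1 B ≤ (1 - Kcon * bareLambda B) * linkCE B :=
        mul_le_mul hexp h1 (topValue_nonneg (ρ := su2Rep) 1 B) (by linarith)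
    _ ≤ secondValue su2Rep 1 B := h2

end Summit.QuantumFields.YangMills.Theorems.FemtoTransferGap

end
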